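import Summits.QuantumFields.QCD.Theorems.QuarksAsStableActionStableActionBridgeTransferLevelOrder
import Summits.QuantumFields.QCD.Theorems.QuarksAsStableActionStableActionBridgeTransferVacuumRayleigh

/-!
# Bounds on the min–max levels of the QCD transfer operator: `λ₀ > 0` and `λₙ ≤ Λ`
(crux `QuarksAsStableAction.StableActionBridge`, item stmt-QuantumFields-9737, line `Sketch`;
registered stub `qcdTransferLevel_zero_pos_and_le` of the lead skeleton)

`Literature/MathematicalPhysics/QuantumFieldTheory/QCDTransferMatrix.lean` defines the min–max levels
of Lüscher's transfer operator `T̂` of lattice QCD with `r = 1` Wilson quarks on the gauge-invariant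
subspace,
`qcdTransferLevel Nf S β mq n = inf_{Φ₁,…,Φₙ ∈ core} sup {R(Ψ) : Ψ ∈ core, 𝔫(Ψ,Ψ) ≠ 0, 𝔫(Φᵢ,Ψ) = 0 ∀ i}`
(`R = transferRayleigh`, `𝔫 = fermionWeightForm`, `core = transferCore`), with the vacuum level the
unconstrained supremum `λ₀ = sup {R(Ψ) : Ψ ∈ core, 𝔫(Ψ,Ψ) ≠ 0}` (`qcdTransferLevel_zero`).
This file proves, for `β ≥ 0` and all bare masses `m_f > −1`:

* **`λ₀ > 0`** (`TransferLevelBounds.qcdTransferLevel_zero_pos`): the constant vacuum wave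
  `Ω : U ↦ |0⟩` lies in the core (`vacuum_mem_transferCore`) and has `𝔫(Ω,Ω) ≠ 0`
  (`fermionWeightForm_vacuum_re_pos`), so it is an admissible trial function and
  `λ₀ ≥ R(Ω) > 0` (`transferRayleigh_vacuum_pos`; the supremum is over a set bounded above because
  `T̂` is bounded, `transferRayleigh_le`);
* **`λₙ ≤ Λ` for every `n`** (`TransferLevelBounds.qcdTransferLevel_le`), with the uniform bound
  `Λ ≥ 0` of `transferRayleigh_le` (`R(Ψ) ≤ Λ` on continuous waves): the level is below the
  constrained supremum of the all-vacuum constraint family (`TransferLevelOrder.qcdTransferLevel_le_sSup`),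
  which is a supremum of values `R(Ψ) ≤ Λ` with `Ψ` in the core, hence continuous (`Real.sSup_le`,
  covering also the empty constrained set, `sSup ∅ = 0 ≤ Λ`);
* the registered conjunction `qcdTransferLevel_zero_pos_and_le`, and the corollary `λ₁ ≤ λ₀`
  (`qcdTransferLevel_one_le_zero`, from `qcdTransferLevel_antitone`) promised by the docstring of
  `qcdTransferGap` in the Literature file.

References: M. Reed, B. Simon, *Methods of Modern Mathematical Physics IV*, Thm XIII.1 (min–max
principle) [ReedSimonIV1978]; M. Lüscher, Commun. Math. Phys. 54 (1977) 283 [Luscher1977, pp. 283–292];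
J. Smit, *Introduction to Quantum Fields on a Lattice*, §6.5 (6.87)–(6.91) [Smit2023].
Pure theorem file (no definitions).
-/

namespace Summit.QuantumFields.QCD.Cruxes.StableActionBridge.Sketch

open scoped ComplexOrder
open MeasureTheory Matrix Literature.MathematicalPhysics.QuantumFieldTheory
  Literature.MathematicalPhysics.QuantumLattice

namespace TransferLevelBounds

variable {Nf S : ℕ} [NeZero S] {β : ℝ} {mq : Fin Nf → ℝ}

/-- The constant vacuum wave `Ω : U ↦ |0⟩` has non-vanishing weight `𝔫(Ω, Ω) ≠ 0` for all
`m_f > −1` (its real part is `> 0`, `fermionWeightForm_vacuum_re_pos`). [folklore] -/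
theorem fermionWeightForm_vacuum_ne_zero (hm : ∀ f, -1 < mq f) :
    fermionWeightForm mq (fun _ : GaugeConfig 3 S (Matrix.specialUnitaryGroup (Fin 3) ℂ) =>
      (vacuum : Fock (SliceFermiIdx Nf S))) (fun _ => vacuum) ≠ 0 :=
  fun h => (fermionWeightForm_vacuum_re_pos Nf S mq hm).ne'
    ((congrArg Complex.re h).trans Complex.zero_re)

/-- The constant vacuum wave is an admissible trial function of the vacuum level: it lies in the
core and has `𝔫(Ω, Ω) ≠ 0`. [folklore] -/
theorem vacuum_mem_trialSet (hm : ∀ f, -1 < mq f) :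
    (fun _ : GaugeConfig 3 S (Matrix.specialUnitaryGroup (Fin 3) ℂ) =>
        (vacuum : Fock (SliceFermiIdx Nf S))) ∈
      {Ψ : SliceWave Nf S | Ψ ∈ transferCore Nf S ∧ fermionWeightForm mq Ψ Ψ ≠ 0} :=
  ⟨vacuum_mem_transferCore, fermionWeightForm_vacuum_ne_zero hm⟩

/-- Every admissible trial function of the vacuum level is continuous (the core consists of
continuous gauge-invariant waves). [folklore] -/
theorem continuous_of_mem_trialSet :
    ∀ Ψ ∈ {Ψ : SliceWave Nf S | Ψ ∈ transferCore Nf S ∧ fermionWeightForm mq Ψ Ψ ≠ 0},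
      Continuous Ψ :=
  fun _ hΨ => hΨ.1.1

/-- **The vacuum Rayleigh quotient is below the vacuum level**, `R(Ω) ≤ λ₀`: `Ω` is an admissible
trial function of the unconstrained supremum `λ₀` (`qcdTransferLevel_zero`), whose trial set has
Rayleigh quotients bounded above (`T̂` bounded). [cite: ReedSimonIV1978, Thm XIII.1] -/
theorem transferRayleigh_vacuum_le_qcdTransferLevel_zero (hβ : 0 ≤ β) (hm : ∀ f, -1 < mq f) :
    transferRayleigh β mq (fun _ : GaugeConfig 3 S (Matrix.specialUnitaryGroup (Fin 3) ℂ) =>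
        (vacuum : Fock (SliceFermiIdx Nf S))) ≤
      qcdTransferLevel Nf S β mq 0 := by
  rw [qcdTransferLevel_zero]
  exact le_csSup (TransferLevelOrder.bddAbove_transferRayleigh_image hβ hm continuous_of_mem_trialSet)
    ⟨_, vacuum_mem_trialSet hm, rfl⟩

/-- **The vacuum level is strictly positive**, `0 < λ₀`, for `β ≥ 0` and all `m_f > −1`:
`λ₀ ≥ R(Ω) > 0` (`transferRayleigh_vacuum_pos`). [cite: Luscher1977, pp. 283–292]
[cite: ReedSimonIV1978, Thm XIII.1] -/
theorem qcdTransferLevel_zero_pos (hβ : 0 ≤ β) (hm : ∀ f, -1 < mq f) :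
    0 < qcdTransferLevel Nf S β mq 0 :=
  (transferRayleigh_vacuum_pos Nf S β mq hm).trans_le
    (transferRayleigh_vacuum_le_qcdTransferLevel_zero hβ hm)

/-- A uniform bound `R(Ψ) ≤ Λ` (`Λ ≥ 0`) on continuous waves bounds the supremum of the Rayleigh
quotient over any set of continuous waves (`Real.sSup_le`; `sSup ∅ = 0 ≤ Λ`). [folklore] -/
theorem sSup_transferRayleigh_image_le {Λ : ℝ} (hΛ0 : 0 ≤ Λ)
    (hΛ : ∀ Ψ : SliceWave Nf S, Continuous Ψ → transferRayleigh β mq Ψ ≤ Λ)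
    {C : Set (SliceWave Nf S)} (hC : ∀ Ψ ∈ C, Continuous Ψ) :
    sSup (transferRayleigh β mq '' C) ≤ Λ := by
  refine Real.sSup_le ?_ hΛ0
  rintro _ ⟨Ψ, hΨ, rfl⟩
  exact hΛ Ψ (hC Ψ hΨ)

/-- **Every min–max level is below the operator bound**, `λₙ ≤ Λ`, for any uniform bound
`R(Ψ) ≤ Λ` (`Λ ≥ 0`) on continuous waves: `λₙ ≤ F_n(Ω,…,Ω) ≤ Λ`, the level being below the
constrained supremum of the all-vacuum constraint family, all of whose trial functions lie in the
core and are therefore continuous. [cite: ReedSimonIV1978, Thm XIII.1] -/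
theorem qcdTransferLevel_le (hβ : 0 ≤ β) (hm : ∀ f, -1 < mq f) {Λ : ℝ} (hΛ0 : 0 ≤ Λ)
    (hΛ : ∀ Ψ : SliceWave Nf S, Continuous Ψ → transferRayleigh β mq Ψ ≤ Λ) (n : ℕ) :
    qcdTransferLevel Nf S β mq n ≤ Λ :=
  (TransferLevelOrder.qcdTransferLevel_le_sSup hβ hm
      (fun (_ : Fin n) (_ : GaugeConfig 3 S (Matrix.specialUnitaryGroup (Fin 3) ℂ)) =>
        (vacuum : Fock (SliceFermiIdx Nf S)))
      fun _ => vacuum_mem_transferCore).trans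
    (sSup_transferRayleigh_image_le hΛ0 hΛ (TransferLevelOrder.continuous_of_mem_constraint _))

end TransferLevelBounds

/-- **The vacuum level of the QCD transfer operator is strictly positive and all min–max levels are
uniformly bounded**: for `β ≥ 0` and all bare quark masses `m_f > −1` there is `Λ` with
`0 < λ₀` and `λₙ ≤ Λ` for every `n` — the vacuum wave `U ↦ |0⟩` is an admissible trial function
with `R > 0`, and `T̂` is bounded (`transferRayleigh_le`).  Registered stub of crux
stmt-QuantumFields-9737, line `Sketch`. [cite: Luscher1977, pp. 283–292]
[cite: ReedSimonIV1978, Thm XIII.1] -/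
theorem qcdTransferLevel_zero_pos_and_le : ∀ (Nf S : ℕ) [NeZero S] (β : ℝ) (mq : Fin Nf → ℝ), 0 ≤ β → (∀ f, -1 < mq f) → ∃ Λ : ℝ, 0 < qcdTransferLevel Nf S β mq 0 ∧ ∀ n, qcdTransferLevel Nf S β mq n ≤ Λ := by
  intro Nf S _ β mq hβ hm
  obtain ⟨Λ, hΛ0, hΛ⟩ := transferRayleigh_le Nf S β mq hβ hm
  exact ⟨Λ, TransferLevelBounds.qcdTransferLevel_zero_pos hβ hm,
    TransferLevelBounds.qcdTransferLevel_le hβ hm hΛ0 hΛ⟩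

/-- **`λ₁ ≤ λ₀`**: the first excited min–max level is below the vacuum level, for `β ≥ 0` and all
`m_f > −1` (the levels are antitone, `qcdTransferLevel_antitone`) — the inequality `λ₀ ≥ λ₁` quoted
in the docstring of `qcdTransferGap`. [cite: ReedSimonIV1978, Thm XIII.1] -/
theorem qcdTransferLevel_one_le_zero (Nf S : ℕ) [NeZero S] (β : ℝ) (mq : Fin Nf → ℝ) (hβ : 0 ≤ β)
    (hm : ∀ f, -1 < mq f) : qcdTransferLevel Nf S β mq 1 ≤ qcdTransferLevel Nf S β mq 0 :=
  (qcdTransferLevel_antitone Nf S β mq hβ hm).1 zero_le_one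

end Summit.QuantumFields.QCD.Cruxes.StableActionBridge.Sketch
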